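import Mathlib
import HarnessLib

/-!
# PCINT lane, PHASE 4 (kernel second-moment oriented route), step 1: oriented words and the renewal bound

Cell `prim-pcint`, seat `prim-pcint-1` (gen 13); memo `run/shared/lean/prim/pcint/T-FIBRE-ROUTE.md` §PHASE 4.

Cox–Durrett's second-moment bound for ORIENTED bond percolation on `ℤ^d` [Cox–Durrett 1983, Math. Proc. Camb. Phil. Soc.
93, (2.1)] compares the number `N_n` of open oriented paths of length `n` from the origin with its second moment.  Two
oriented paths, coded by words `w, w' : Fin n → Fin d` (letter `a` = step `+e_a`), share exactly the edges at the indices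
`i` where they sit at the same vertex and take the same step; with an initial offset `y` between the walkers this count is
`K y w w'`.  This file proves the purely combinatorial RENEWAL BOUND

  `S x n 0 = Σ_{w,w'} x^{K 0 w w'} ≤ d^{2n} / (1 − (x−1) G / d)`   (`OSM.S_zero_le`)

for `x ≥ 1` and any `G` with `Σ_{k<n} u k ≤ G` for all `n` and `(x−1) G / d < 1`, where `u k = cnt k 0 / d^{2k}` is the
probability that two independent oriented walks of `k` steps end at the same vertex (`cnt k y` counts the pairs with
`y + pos w = pos w'`).  Proof: the first-letter recursions `S_succ`, `cnt_succ`, the Duhamel identity `S_eq`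
(`S x n y = d^{2n} + (x−1)·d·Σ_{i<n} S x i 0 · cnt (n−1−i) y`) and a strong induction.
-/

noncomputable section

namespace Summit.CriticalPhenomena.PercolationContinuityZ3.Theorems.Pcint.OSM

open Finset

variable {d : ℕ}

/-! ### Positions and the shared-edge count -/

/-- The unit vector `e_a ∈ ℤ^d`. -/
def e (a : Fin d) : Fin d → ℤ := Pi.single a 1

/-- **Position after `i` steps** of the oriented walk coded by the word `w`: coordinate `j` counts the letters `j` among
the first `i` letters. -/
def pos {n : ℕ} (w : Fin n → Fin d) (i : ℕ) : Fin d → ℤ :=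
  fun j => ∑ t : Fin n, if (t : ℕ) < i ∧ w t = j then (1 : ℤ) else 0

/-- **Shared edges with offset `y`**: the indices `i` at which the walker `w` started at `y` and the walker `w'` started
at `0` sit at the same vertex and take the same step. -/
def K {n : ℕ} (y : Fin d → ℤ) (w w' : Fin n → Fin d) : ℕ :=
  (univ.filter fun i : Fin n => y + pos w i = pos w' i ∧ w i = w' i).card

/-- Nothing happens before the first step. -/
theorem pos_zero {n : ℕ} (w : Fin n → Fin d) : pos w 0 = 0 := by
  funext j; simp [pos]

/-- First-letter recursion of positions: `pos (a :: w) (i+1) = e_a + pos w i`. -/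
theorem pos_cons_succ {n : ℕ} (a : Fin d) (w : Fin n → Fin d) (i : ℕ) :
    pos (Fin.cons a w : Fin (n + 1) → Fin d) (i + 1) = e a + pos w i := by
  funext j
  simp only [pos, e, Pi.add_apply, Fin.sum_univ_succ, Fin.cons_zero, Fin.cons_succ, Fin.val_zero,
    Nat.zero_lt_succ, true_and, Fin.val_succ, Nat.succ_lt_succ_iff, Pi.single_apply]
  congr 1
  by_cases h : a = j
  · subst h; simp
  · rw [if_neg h, if_neg (Ne.symm h)]

/-- The shared-edge count as a sum of indicators. -/
theorem K_eq_sum {n : ℕ} (y : Fin d → ℤ) (w w' : Fin n → Fin d) :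
    K y w w' = ∑ i : Fin n, if y + pos w i = pos w' i ∧ w i = w' i then 1 else 0 := by
  rw [K, Finset.card_filter]

/-- First-letter recursion of the shared-edge count. -/
theorem K_cons {n : ℕ} (y : Fin d → ℤ) (a a' : Fin d) (w w' : Fin n → Fin d) :
    K y (Fin.cons a w : Fin (n + 1) → Fin d) (Fin.cons a' w') =
      (if y = 0 ∧ a = a' then 1 else 0) + K (y + e a - e a') w w' := by
  rw [K_eq_sum, K_eq_sum, Fin.sum_univ_succ]
  congr 1
  · simp [pos_zero]
  · refine Finset.sum_congr rfl fun t _ => ?_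
    simp only [Fin.val_succ, pos_cons_succ, Fin.cons_succ]
    have hiff : y + (e a + pos w t) = e a' + pos w' t ↔ y + e a - e a' + pos w t = pos w' t := by
      constructor <;> intro h
      · linear_combination h
      · linear_combination h
    simp only [hiff]

/-! ### The pair sums -/

/-- **`S x n y = Σ_{w,w'} x^{K y w w'}`** over pairs of words of length `n`. -/
def S (d : ℕ) (x : ℝ) (n : ℕ) (y : Fin d → ℤ) : ℝ :=
  ∑ w : Fin n → Fin d, ∑ w' : Fin n → Fin d, x ^ K y w w'

/-- **`cnt n y`** = the number of pairs of words of length `n` with `y + pos w = pos w'` (the two walkers end together). -/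
def cnt (d : ℕ) (n : ℕ) (y : Fin d → ℤ) : ℝ :=
  ∑ w : Fin n → Fin d, ∑ w' : Fin n → Fin d, if y + pos w n = pos w' n then (1 : ℝ) else 0

/-- **`u k`** = the probability that two independent oriented walks of `k` steps from the origin end at the same vertex. -/
def u (d : ℕ) (k : ℕ) : ℝ := cnt d k 0 / (d : ℝ) ^ (2 * k)

/-- Sums over words of length `n+1` by first letter. -/
theorem sum_word_succ {α : Type*} [AddCommMonoid α] {n : ℕ} (f : (Fin (n + 1) → Fin d) → α) :
    ∑ w : Fin (n + 1) → Fin d, f w = ∑ a : Fin d, ∑ w : Fin n → Fin d, f (Fin.cons a w) := by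
  rw [← (Fin.consEquiv fun _ => Fin d).sum_comp f, Fintype.sum_prod_type]
  rfl

/-- Empty words share no edge. -/
theorem S_zero (x : ℝ) (y : Fin d → ℤ) : S d x 0 y = 1 := by
  simp [S, K]

/-- Empty walks end together iff they start together. -/
theorem cnt_zero (y : Fin d → ℤ) : cnt d 0 y = if y = 0 then 1 else 0 := by
  unfold cnt
  simp_rw [pos_zero, add_zero]
  rw [Fintype.sum_unique, Fintype.sum_unique]

/-- Pair counts are nonnegative. -/
theorem cnt_nonneg (n : ℕ) (y : Fin d → ℤ) : 0 ≤ cnt d n y :=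
  Finset.sum_nonneg fun _ _ => Finset.sum_nonneg fun _ _ => by split_ifs <;> norm_num

/-- Meeting probabilities are nonnegative. -/
theorem u_nonneg (k : ℕ) : 0 ≤ u d k := div_nonneg (cnt_nonneg k 0) (by positivity)

/-- First-letter recursion of `S`. -/
theorem S_succ (x : ℝ) (n : ℕ) (y : Fin d → ℤ) :
    S d x (n + 1) y = ∑ a : Fin d, ∑ a' : Fin d,
      x ^ (if y = 0 ∧ a = a' then 1 else 0) * S d x n (y + e a - e a') := by
  unfold S
  rw [sum_word_succ]
  refine Finset.sum_congr rfl fun a _ => ?_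
  simp_rw [sum_word_succ (fun w' => x ^ K y (Fin.cons a _) w')]
  rw [Finset.sum_comm]
  refine Finset.sum_congr rfl fun a' _ => ?_
  rw [Finset.mul_sum]
  refine Finset.sum_congr rfl fun w _ => ?_
  rw [Finset.mul_sum]
  refine Finset.sum_congr rfl fun w' _ => ?_
  rw [K_cons, pow_add]

/-- First-letter recursion of `cnt`. -/
theorem cnt_succ (n : ℕ) (y : Fin d → ℤ) :
    cnt d (n + 1) y = ∑ a : Fin d, ∑ a' : Fin d, cnt d n (y + e a - e a') := by
  unfold cnt
  rw [sum_word_succ]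
  refine Finset.sum_congr rfl fun a _ => ?_
  simp_rw [sum_word_succ (fun w' : Fin (n + 1) → Fin d =>
    if y + pos (Fin.cons a _ : Fin (n + 1) → Fin d) (n + 1) = pos w' (n + 1) then (1 : ℝ) else 0)]
  rw [Finset.sum_comm]
  refine Finset.sum_congr rfl fun a' _ => Finset.sum_congr rfl fun w _ => Finset.sum_congr rfl fun w' _ => ?_
  simp only [pos_cons_succ]
  have hiff : y + (e a + pos w n) = e a' + pos w' n ↔ y + e a - e a' + pos w n = pos w' n := by
    constructor <;> intro h
    · linear_combination h
    · linear_combination h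
  simp only [hiff]

/-- `Σ_{a,a'} of a constant`. -/
theorem sum_sum_const (c : ℝ) : ∑ _a : Fin d, ∑ _a' : Fin d, c = (d : ℝ) ^ 2 * c := by
  simp [Finset.sum_const, Finset.card_univ, Fintype.card_fin]; ring

/-- `Σ_{a,a'} (C + g) = d² C + Σ_{a,a'} g`. -/
theorem sum_sum_const_add (C : ℝ) (g : Fin d → Fin d → ℝ) :
    ∑ a : Fin d, ∑ a' : Fin d, (C + g a a') = (d : ℝ) ^ 2 * C + ∑ a : Fin d, ∑ a' : Fin d, g a a' := by
  simp_rw [Finset.sum_add_distrib]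
  rw [sum_sum_const]

/-- Pulling a finite linear combination out of `Σ_{a,a'}`. -/
theorem sum_sum_mul_sum (c : ℝ) (s : Finset ℕ) (f : ℕ → ℝ) (t : ℕ → Fin d → Fin d → ℝ) :
    ∑ a : Fin d, ∑ a' : Fin d, c * ∑ i ∈ s, f i * t i a a' =
      c * ∑ i ∈ s, f i * ∑ a : Fin d, ∑ a' : Fin d, t i a a' := by
  calc ∑ a : Fin d, ∑ a' : Fin d, c * ∑ i ∈ s, f i * t i a a'
      = ∑ a : Fin d, ∑ a' : Fin d, ∑ i ∈ s, c * (f i * t i a a') := by simp_rw [Finset.mul_sum]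
    _ = ∑ a : Fin d, ∑ i ∈ s, ∑ a' : Fin d, c * (f i * t i a a') :=
        Finset.sum_congr rfl fun _ _ => Finset.sum_comm
    _ = ∑ i ∈ s, ∑ a : Fin d, ∑ a' : Fin d, c * (f i * t i a a') := Finset.sum_comm
    _ = c * ∑ i ∈ s, f i * ∑ a : Fin d, ∑ a' : Fin d, t i a a' := by simp_rw [Finset.mul_sum]

/-- **The Duhamel identity**: `S x n y = d^{2n} + (x−1)·d·Σ_{i<n} S x i 0 · cnt (n−1−i) y`. -/
theorem S_eq (x : ℝ) : ∀ (n : ℕ) (y : Fin d → ℤ),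
    S d x n y = (d : ℝ) ^ (2 * n) + (x - 1) * d * ∑ i ∈ range n, S d x i 0 * cnt d (n - 1 - i) y
  | 0, y => by simp [S_zero]
  | n + 1, y => by
    rw [S_succ]
    have hx : ∀ (a a' : Fin d), x ^ (if y = 0 ∧ a = a' then 1 else 0) =
        1 + (x - 1) * (if y = 0 ∧ a = a' then 1 else 0) := by
      intro a a'; split_ifs <;> simp
    simp_rw [hx, add_mul, one_mul, Finset.sum_add_distrib]
    -- first part: the free evolution
    have hcnt : ∀ i ∈ range n, ∑ a : Fin d, ∑ a' : Fin d, cnt d (n - 1 - i) (y + e a - e a') = cnt d (n - i) y := by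
      intro i hi
      have hi' : i < n := mem_range.1 hi
      obtain ⟨m, hm⟩ : ∃ m, n - i = m + 1 := ⟨n - 1 - i, by omega⟩
      rw [hm, cnt_succ]
      have : n - 1 - i = m := by omega
      rw [this]
    have h1 : ∑ a : Fin d, ∑ a' : Fin d, S d x n (y + e a - e a') =
        (d : ℝ) ^ (2 * (n + 1)) + (x - 1) * d * ∑ i ∈ range n, S d x i 0 * cnt d (n - i) y := by
      simp_rw [S_eq x n]
      rw [sum_sum_const_add, sum_sum_mul_sum, Finset.sum_congr rfl fun i hi => by rw [hcnt i hi]]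
      ring
    -- second part: the renewal term
    have h2 : ∑ a : Fin d, ∑ a' : Fin d, (x - 1) * (if y = 0 ∧ a = a' then 1 else 0) * S d x n (y + e a - e a') =
        (x - 1) * d * (S d x n 0 * cnt d 0 y) := by
      rw [cnt_zero]
      by_cases hy : y = 0
      · subst hy
        rw [if_pos rfl, mul_one]
        have inner : ∀ a : Fin d, ∑ a' : Fin d, (x - 1) * (if (0 : Fin d → ℤ) = 0 ∧ a = a' then (1 : ℝ) else 0) *
            S d x n (0 + e a - e a') = (x - 1) * S d x n 0 := by
          intro a
          rw [Finset.sum_eq_single a]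
          · rw [if_pos ⟨rfl, rfl⟩, zero_add, sub_self, mul_one]
          · intro a' _ h
            rw [if_neg (fun hh => h hh.2.symm), mul_zero, zero_mul]
          · intro h; exact absurd (Finset.mem_univ a) h
        rw [Finset.sum_congr rfl fun a _ => inner a, Finset.sum_const, Finset.card_univ, Fintype.card_fin,
          nsmul_eq_mul]
        ring
      · rw [if_neg hy, mul_zero, mul_zero]
        refine Finset.sum_eq_zero fun a _ => Finset.sum_eq_zero fun a' _ => ?_
        rw [if_neg (fun h => hy h.1), mul_zero, zero_mul]
    rw [h1, h2, Finset.sum_range_succ, Nat.add_sub_cancel, Nat.sub_self]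
    have hre : ∑ i ∈ range n, S d x i 0 * cnt d (n - i) y = ∑ i ∈ range n, S d x i 0 * cnt d (n + 1 - 1 - i) y := by
      simp_rw [Nat.add_sub_cancel]
    rw [hre]; ring

/-- The identity at `y = 0` in normalised form: `b_n = 1 + ((x−1)/d) Σ_{i<n} b_i u_{n−1−i}`. -/
theorem S_zero_div_eq (x : ℝ) (hd : 0 < d) (n : ℕ) :
    S d x n 0 / (d : ℝ) ^ (2 * n) =
      1 + (x - 1) / d * ∑ i ∈ range n, S d x i 0 / (d : ℝ) ^ (2 * i) * u d (n - 1 - i) := by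
  have hd' : (d : ℝ) ≠ 0 := by exact_mod_cast hd.ne'
  rw [S_eq x n 0, add_div, div_self (pow_ne_zero _ hd'), Finset.mul_sum, Finset.sum_div, Finset.mul_sum]
  congr 1
  refine Finset.sum_congr rfl fun i hi => ?_
  have hi' : i < n := mem_range.1 hi
  unfold u
  have hpow : (d : ℝ) ^ (2 * n) = (d : ℝ) ^ 2 * (d : ℝ) ^ (2 * i) * (d : ℝ) ^ (2 * (n - 1 - i)) := by
    rw [← pow_add, ← pow_add]; congr 1; omega
  rw [hpow]
  field_simp

/-- **The renewal bound**: if `Σ_{k<n} u k ≤ G` for every `n`, `x ≥ 1` and `(x−1) G / d < 1`, then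
`S x n 0 ≤ d^{2n} / (1 − (x−1) G / d)`. -/
theorem S_zero_le {x G : ℝ} (hd : 0 < d) (hx : 1 ≤ x) (hG : ∀ n, ∑ k ∈ range n, u d k ≤ G)
    (hcG : (x - 1) / d * G < 1) (n : ℕ) :
    S d x n 0 ≤ (d : ℝ) ^ (2 * n) / (1 - (x - 1) / d * G) := by
  have hdpos : (0 : ℝ) < (d : ℝ) ^ (2 * n) := by positivity
  have hc : 0 ≤ (x - 1) / d := div_nonneg (by linarith) (by positivity)
  have hB : 0 < 1 - (x - 1) / d * G := by linarith
  set B := 1 / (1 - (x - 1) / d * G) with hBdef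
  -- strong induction on the normalised quantity
  suffices h : ∀ n, S d x n 0 / (d : ℝ) ^ (2 * n) ≤ B by
    have := h n
    rw [div_le_iff₀ hdpos] at this
    rw [hBdef] at this
    simpa [div_eq_mul_inv, mul_comm] using this
  intro n
  induction n using Nat.strong_induction_on with
  | _ n ih =>
    rw [S_zero_div_eq x hd n]
    have hG0 : 0 ≤ G := le_trans (by simp) (hG 0)
    calc 1 + (x - 1) / d * ∑ i ∈ range n, S d x i 0 / (d : ℝ) ^ (2 * i) * u d (n - 1 - i)
        ≤ 1 + (x - 1) / d * ∑ i ∈ range n, B * u d (n - 1 - i) := by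
          gcongr with i hi
          · exact u_nonneg _
          · exact ih i (mem_range.1 hi)
      _ = 1 + (x - 1) / d * (B * ∑ k ∈ range n, u d k) := by
          rw [← Finset.mul_sum, Finset.sum_range_reflect (u d) n]
      _ ≤ 1 + (x - 1) / d * (B * G) := by
          have hBpos : 0 < B := by rw [hBdef]; positivity
          gcongr
          exact hG n
      _ = B := by
          have hBG : B * (1 - (x - 1) / d * G) = 1 := by rw [hBdef, one_div, inv_mul_cancel₀ hB.ne']
          linear_combination (-1 : ℝ) * hBG

end Summit.CriticalPhenomena.PercolationContinuityZ3.Theorems.Pcint.OSM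

end
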